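import Mathlib
import Summits.KontsevichZagierPeriods.Zeta5Search.ClusterValuationKBounds
import HarnessLib

/-!
# ζ(5) search — the Fermat-quotient weights `g₀ = p²φ²`, `g₁ ≡ 2pφ (mod p²)`, `φ_{k+ℓp} ≡ φ_k − ℓ (mod p)` of the `𝒦`-digit

Cell `pub-zeta5` (HONEST FRAMING: systematic search; no irrationality claim unless certified), typer seat
generation 9.  Arithmetic input of gen-2 g9's first-digit lemma U-K (`KDigit`, `Zeta5Search/UniversalDigit.lean` §2): the
Taylor coefficients `g_o(k) = [(t+k)^o](t^p − t)²` (`taylorTT`) of orders `o = 0, 1` in terms of `φ_k := (k^p − k)/p`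
(`k`-times the Fermat quotient of `k`):

* `taylorTT_zero_eq` : `g₀(k) = p²·φ_k²`;  `taylorTT_one_sub` : `g₁(k) − 2p·φ_k = −2p²·k^{p−1}·φ_k`, so `p² ∣ g₁(k) − 2pφ_k`;
* `fq_shift_dvd` : `p ∣ φ_{k+pℓ} − (φ_k − ℓ)` (from `p² ∣ (k+pℓ)^p − k^p`);
and their `p`-adic norm forms.  Elementary congruences of integers; nothing about irrationality.
-/

namespace Summit.KontsevichZagierPeriods.Zeta5Search.ClusterValuation

open Summit.KontsevichZagierPeriods.Zeta5Search.PadicSeries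

/-- gen-2's `φ_k := (k^p − k)/p` (an integer by Fermat's little theorem). -/
def fq (p : ℕ) (k : ℤ) : ℤ := (k ^ p - k) / p

section IntFacts

variable {p : ℕ}

/-- Fermat: `p ∣ k^p − k`. -/
theorem natPrime_dvd_pow_sub_self (hp : p.Prime) (k : ℤ) : (p : ℤ) ∣ k ^ p - k := by
  haveI := Fact.mk hp
  rw [← ZMod.intCast_zmod_eq_zero_iff_dvd]
  push_cast
  rw [ZMod.pow_card, sub_self]

/-- `p·φ_k = k^p − k`. -/
theorem p_mul_fq (hp : p.Prime) (k : ℤ) : (p : ℤ) * fq p k = k ^ p - k :=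
  Int.mul_ediv_cancel' (natPrime_dvd_pow_sub_self hp k)

/-- **`g₀(k) = p² φ_k²`** (odd prime `p`). -/
theorem taylorTT_zero_eq (hp : p.Prime) (hp2 : p ≠ 2) (k : ℤ) : taylorTT p 0 k = (p : ℤ) ^ 2 * fq p k ^ 2 := by
  have hodd : Odd p := hp.odd_of_ne_two hp2
  have h : taylorTT p 0 k = ((-k) ^ p - (-k)) ^ 2 := by
    rw [taylorTT]
    simp only [Nat.choose_zero_right, Nat.cast_one, one_mul, Nat.sub_zero, mul_one]
    generalize -k = a
    ring
  rw [h, hodd.neg_pow, show (-k ^ p - -k) ^ 2 = (k ^ p - k) ^ 2 by ring, ← p_mul_fq hp k]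
  ring

/-- **`g₁(k) − 2pφ_k = −2p²k^{p−1}φ_k`** (odd prime `p`). -/
theorem taylorTT_one_sub (hp : p.Prime) (hp2 : p ≠ 2) (k : ℤ) :
    taylorTT p 1 k - 2 * p * fq p k = -2 * (p : ℤ) * k ^ (p - 1) * ((p : ℤ) * fq p k) := by
  obtain ⟨m, hm⟩ : ∃ m, p = m + 1 := ⟨p - 1, (Nat.sub_add_cancel hp.one_le).symm⟩
  have hF := p_mul_fq hp k
  have hodd : Odd p := hp.odd_of_ne_two hp2
  have hodd' : Odd (2 * p - 1) := by
    refine ⟨m, ?_⟩; omega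
  have h1 : taylorTT p 1 k = 2 * (p : ℤ) * (-k) ^ (2 * p - 1) - 2 * ((p : ℤ) + 1) * (-k) ^ p + 2 * (-k) := by
    rw [taylorTT]
    simp only [Nat.choose_one_right, Nat.add_sub_cancel, Nat.cast_mul, Nat.cast_ofNat, Nat.cast_add, Nat.cast_one,
      show (2 : ℕ).choose 1 = 2 by rfl, show (2 : ℕ) - 1 = 1 by rfl, pow_one]
  rw [h1, hodd'.neg_pow, hodd.neg_pow]
  subst hm
  rw [show 2 * (m + 1) - 1 = m + 1 + m by omega, Nat.add_sub_cancel, pow_add] at *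
  push_cast at hF ⊢
  linear_combination (-2 + 2 * ((m : ℤ) + 1) * k ^ m) * hF

/-- **`p² ∣ g₁(k) − 2pφ_k`**. -/
theorem taylorTT_one_sub_dvd (hp : p.Prime) (hp2 : p ≠ 2) (k : ℤ) : (p : ℤ) ^ 2 ∣ taylorTT p 1 k - 2 * p * fq p k := by
  rw [taylorTT_one_sub hp hp2 k]
  exact ⟨-2 * k ^ (p - 1) * fq p k, by ring⟩

/-- `p² ∣ (k + pℓ)^p − k^p`. -/
theorem sq_dvd_add_mul_pow_sub (p : ℕ) (k ℓ : ℤ) : (p : ℤ) ^ 2 ∣ (k + p * ℓ) ^ p - k ^ p := by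
  have h := sq_dvd_add_pow_sub_sub ((p : ℤ) * ℓ) k p
  have h1 : (p : ℤ) ^ 2 ∣ ((p : ℤ) * ℓ) ^ 2 := ⟨ℓ ^ 2, by ring⟩
  have h2 : (p : ℤ) ^ 2 ∣ k ^ (p - 1) * ((p : ℤ) * ℓ) * (p : ℕ) := ⟨k ^ (p - 1) * ℓ, by ring⟩
  have h3 : (k + (p : ℤ) * ℓ) ^ p - k ^ p =
      ((k + (p : ℤ) * ℓ) ^ p - k ^ (p - 1) * ((p : ℤ) * ℓ) * (p : ℕ) - k ^ p) + k ^ (p - 1) * ((p : ℤ) * ℓ) * (p : ℕ) := by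
    ring
  rw [h3]
  exact (h1.trans h).add h2

/-- **`p ∣ φ_{k+pℓ} − (φ_k − ℓ)`**: the Fermat quotient drops by `ℓ` when `k` moves up `ℓ` levels. -/
theorem fq_shift_dvd (hp : p.Prime) (k ℓ : ℤ) : (p : ℤ) ∣ fq p (k + p * ℓ) - (fq p k - ℓ) := by
  have hp0 : (p : ℤ) ≠ 0 := by exact_mod_cast hp.ne_zero
  obtain ⟨c, hc⟩ := sq_dvd_add_mul_pow_sub p k ℓ
  refine ⟨c, ?_⟩
  have h1 := p_mul_fq hp (k + p * ℓ)
  have h2 := p_mul_fq hp k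
  have : (p : ℤ) * (fq p (k + p * ℓ) - (fq p k - ℓ)) = (p : ℤ) * ((p : ℤ) * c) := by
    rw [mul_sub, mul_sub, h1, h2]
    linear_combination hc
  exact mul_left_cancel₀ hp0 (by rw [this]; try ring)

end IntFacts

/-! ### `p`-adic norm forms -/

section Norms

variable {p : ℕ} [hp : Fact p.Prime]

/-- `‖φ_k‖_p ≤ 1`. -/
theorem padicNorm_fq_le_one (k : ℤ) : padicNorm p ((fq p k : ℚ)) ≤ 1 := padicNorm.of_int _

/-- `g₀(k) = p²φ_k²` in `ℚ`. -/
theorem taylorTT_zero_cast (hp2 : p ≠ 2) (k : ℤ) :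
    ((taylorTT p 0 k : ℤ) : ℚ) = (p : ℚ) ^ 2 * ((fq p k : ℚ)) ^ 2 := by
  rw [taylorTT_zero_eq hp.out hp2 k]; push_cast; ring

/-- `‖g₁(k) − 2pφ_k‖_p ≤ p^{−2}`. -/
theorem padicNorm_taylorTT_one_sub_le (hp2 : p ≠ 2) (k : ℤ) :
    padicNorm p (((taylorTT p 1 k : ℤ) : ℚ) - 2 * (p : ℚ) * (fq p k : ℚ)) ≤ (p : ℚ) ^ (-(2 : ℤ)) := by
  have h := taylorTT_one_sub_dvd hp.out hp2 k
  have hcast : (((taylorTT p 1 k : ℤ) : ℚ) - 2 * (p : ℚ) * (fq p k : ℚ)) = (((taylorTT p 1 k - 2 * p * fq p k : ℤ)) : ℚ) := by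
    push_cast; ring
  rw [hcast]
  have := padicNorm.dvd_iff_norm_le.1 (show ((p ^ 2 : ℕ) : ℤ) ∣ taylorTT p 1 k - 2 * p * fq p k by simpa using h)
  simpa using this

/-- `‖g₁(k)‖_p ≤ p^{−1}` (`p ≥ 5`). -/
theorem padicNorm_taylorTT_one_le (h5 : 5 ≤ p) (k : ℤ) :
    padicNorm p (((taylorTT p 1 k : ℤ) : ℚ)) ≤ (p : ℚ) ^ (-(1 : ℤ)) := by
  have := padicNorm_taylorTT_sub_le (p := p) h5 (o := 1) (by norm_num) k
  rwa [if_neg (by decide), sub_zero] at this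

/-- `‖φ_{k+pℓ} − (φ_k − ℓ)‖_p ≤ p^{−1}`. -/
theorem padicNorm_fq_shift_le (k ℓ : ℤ) :
    padicNorm p ((fq p (k + p * ℓ) : ℚ) - ((fq p k : ℚ) - ℓ)) ≤ (p : ℚ) ^ (-(1 : ℤ)) := by
  have h := fq_shift_dvd hp.out k ℓ
  have hcast : ((fq p (k + p * ℓ) : ℚ) - ((fq p k : ℚ) - ℓ)) = (((fq p (k + p * ℓ) - (fq p k - ℓ) : ℤ)) : ℚ) := by
    push_cast; ring
  rw [hcast]
  have := padicNorm.dvd_iff_norm_le.1 (show ((p ^ 1 : ℕ) : ℤ) ∣ fq p (k + p * ℓ) - (fq p k - ℓ) by simpa using h)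
  simpa using this

/-- `‖φ_{k+pℓ}² − (φ_k − ℓ)²‖_p ≤ p^{−1}`. -/
theorem padicNorm_fq_shift_sq_le (k ℓ : ℤ) :
    padicNorm p ((fq p (k + p * ℓ) : ℚ) ^ 2 - ((fq p k : ℚ) - ℓ) ^ 2) ≤ (p : ℚ) ^ (-(1 : ℤ)) := by
  rw [sq_sub_sq, padicNorm.mul]
  have hint : padicNorm p ((fq p (k + p * ℓ) : ℚ) + ((fq p k : ℚ) - ℓ)) ≤ 1 := by
    have : ((fq p (k + p * ℓ) : ℚ) + ((fq p k : ℚ) - ℓ)) = (((fq p (k + p * ℓ) + (fq p k - ℓ) : ℤ)) : ℚ) := by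
      push_cast; ring
    rw [this]; exact padicNorm.of_int _
  calc padicNorm p ((fq p (k + p * ℓ) : ℚ) + ((fq p k : ℚ) - ℓ)) * padicNorm p ((fq p (k + p * ℓ) : ℚ) - ((fq p k : ℚ) - ℓ))
      ≤ 1 * (p : ℚ) ^ (-(1 : ℤ)) := mul_le_mul hint (padicNorm_fq_shift_le k ℓ) (padicNorm.nonneg _) zero_le_one
    _ = _ := one_mul _

end Norms

end Summit.KontsevichZagierPeriods.Zeta5Search.ClusterValuation
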